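import Summits.BirchSwinnertonDyer.BirchSwinnertonDyer.Theorems.BiquadraticEisensteinDescentManinDatumSupercuspidalCMInertResolventBoundReductionJZero
import Summits.BirchSwinnertonDyer.BirchSwinnertonDyer.Theorems.BiquadraticEisensteinDescentManinDatumSupercuspidalCMInertResolventCertificateAlgebraJZero
import Literature.NumberTheory.EllipticCurves.EisensteinLatticeCMThree
import HarnessLib

set_option linter.dupNamespace false -- `Summit.BirchSwinnertonDyer.BirchSwinnertonDyer.Theorems.…` (summit = sub, D-0017)
set_option autoImplicit false

/-!
# Crux `ManinDatumSupercuspidalCMInert` (stmt-BirchSwinnertonDyer-20111, BED r605), stub `stub_S5` (`j = 0` at `p = 5`) — the ANALYTIC LABELS of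
# the resolvent certificate: the `5`-division values `π_{e_a} = X(t_{e_a})⁻¹` at `e_a = (1−ρ)^a (mod 5) = (0,1), (4,1), (2,0), (4,2)` are the
# certificate polynomials `P_a(π_{e₀}, ρ)` of `…ResolventCertificateAlgebraJZero`

Route `BiquadraticEisensteinDescent` (cell `pub/bsd-wall`, width seat `bsd-wall-cm-bed-w1` g8; `--supports` stmt-BirchSwinnertonDyer-20111,
helper). THEOREMS ONLY (no definition, no named fact, no `sorry`); nothing is closed by this file and BSD is not proved by any of it.

Inputs: p641325 (`ψ₅(X(t_d)) = 0`), p642033 (division points `t_d = (d₁ρ + d₂)/5`, `t_{−d} + t_d ∈ Λ`, `t_d ∉ Λ`), Literature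
`EisensteinLatticeCMThree` (p643757: `π((1−ρ)z) = −3ρX(z)²/(X(z)³ − 4)`) and the algebraic certificate p644742 (`label_one/two/three_eq`:
`P_{a+1}` is THE solution of `x·(1 − 4P_a³) = −3ρP_a`).

* `divPointRho_oneSubRhoMul_sub_mem` — `t_{(1−ρ)·d} ≡ (1−ρ)t_d (mod Λ)`, `(1−ρ)·d = (2d₁ − d₂, d₁ + d₂)`;
* `normalizedX_divPointRho_ne_zero`, `F_of_divPointRho` — `X(t_d) ≠ 0` and `π_d = X(t_d)⁻¹` is a root of
  `F(p) = p¹² − 25/4·p⁹ + 15/16·p⁶ + 95/64·p³ − 5/256` (`d ≠ 0`); `inv_normalizedX_divPointRho_neg` (`π_{−d} = π_d`);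
* `inv_normalizedX_of_oneSubRho_congr` — `u ≡ (1−ρ)t (mod Λ)`, `u ∉ Λ`, `X(t), X(u) ≠ 0` ⇒ `1 − 4π(t)³ ≠ 0` and `π(u)·(1 − 4π(t)³) = −3ρπ(t)`;
* `e_ne_zero`, `divPoint_e_one/two/three_congr` — `t_{e_{a+1}} ≡ (1−ρ)t_{e_a} (mod Λ)` for the four base points;
* ★ `pi_e_one`, `pi_e_two`, `pi_e_three` — **`π_{(4,1)} = P₁(π_{(0,1)}, ρ)`, `π_{(2,0)} = P₂(π_{(0,1)}, ρ)`, `π_{(4,2)} = P₃(π_{(0,1)}, ρ)`** with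
  `P₁ = −64/27ρp¹⁰ + 128/9ρp⁷ + 4/3ρp⁴ − 86/27ρp`, `P₂ = (1+ρ)(−256/81p¹⁰ + 544/27p⁷ − 148/27p⁴ − 284/81p)`,
  `P₃ = 448/81p¹⁰ − 928/27p⁷ + 112/27p⁴ + 623/81p` (`p = π_{(0,1)}`).

The orbit form of the resolvents and the readout follow in the sequel file. [cite: Lawden1989, §9.8 eq. (9.8.14)] [cite: Serre1979, Ch. IV §2 Prop. 7]
-/

noncomputable section

open scoped Classical
open Complex PeriodPair
open Literature.NumberTheory.EllipticCurves

namespace Summit.BirchSwinnertonDyer.BirchSwinnertonDyer.Theorems.BiquadraticEisensteinDescentManinDatumSupercuspidalCMInertResolventLabelsJZero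

open Summit.BirchSwinnertonDyer.BirchSwinnertonDyer.Theorems.BiquadraticEisensteinDescentManinDatumSupercuspidalCMInertFiveDivisionEisensteinJZero
  (varpiRho_pos psi_five_weierstrassP_div_rho)
open Summit.BirchSwinnertonDyer.BirchSwinnertonDyer.Theorems.BiquadraticEisensteinDescentManinDatumSupercuspidalCMInertTorsionCoordinatesJZero
  (five_mul_divPointRho_mem divPointRho_notMem divPointRho_neg_add_mem)
open Summit.BirchSwinnertonDyer.BirchSwinnertonDyer.Theorems.BiquadraticEisensteinDescentManinDatumSupercuspidalCMInertResolventBoundReductionJZero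
  (inv_normalizedX_divPointRho_rhoMul)
open Summit.BirchSwinnertonDyer.BirchSwinnertonDyer.Theorems.BiquadraticEisensteinDescentManinDatumSupercuspidalCMInertResolventCertificateAlgebraJZero
  (label_one_eq label_two_eq label_three_eq)

/-! ## §1 Division-point bookkeeping for `[1 − ρ]` and `[−1]` -/

/-- **`t_{(1−ρ)·d} ≡ (1−ρ)·t_d (mod Λ)`** for `(1−ρ)·d = (2d₁ − d₂, d₁ + d₂)`: `(1−ρ)(d₁ρ + d₂) = (2d₁ − d₂)ρ + (d₁ + d₂)` and the representatives
agree modulo `5`. [folklore] -/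
theorem divPointRho_oneSubRhoMul_sub_mem (d : ZMod 5 × ZMod 5) :
    ((((2 * d.1 - d.2).val : ℂ) * UpperHalfPlane.ρ + ((d.1 + d.2).val : ℂ)) / 5 -
        (1 - (UpperHalfPlane.ρ : ℂ)) * (((d.1.val : ℂ) * UpperHalfPlane.ρ + (d.2.val : ℂ)) / 5)) ∈
      (ofUpperHalfPlane UpperHalfPlane.ρ).lattice := by
  have key1 : ∀ x y : ZMod 5, ∃ e : ℤ, ((2 * x - y).val : ℤ) - 2 * x.val + y.val = 5 * e := by
    intro x y; fin_cases x <;> fin_cases y <;>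
      first | exact ⟨0, by decide⟩ | exact ⟨1, by decide⟩ | exact ⟨-1, by decide⟩
  have key2 : ∀ x y : ZMod 5, ∃ e : ℤ, (((x + y).val : ℤ) - x.val - y.val) = 5 * e := by
    intro x y; fin_cases x <;> fin_cases y <;> first | exact ⟨0, by decide⟩ | exact ⟨-1, by decide⟩
  obtain ⟨e1, he1⟩ := key1 d.1 d.2
  obtain ⟨e2, he2⟩ := key2 d.1 d.2
  rw [EisensteinLattice.mem_lattice_iff]
  refine ⟨e1, e2, ?_⟩
  have h1 : (((2 * d.1 - d.2).val : ℂ)) - 2 * (d.1.val : ℂ) + (d.2.val : ℂ) = 5 * (e1 : ℂ) := by exact_mod_cast he1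
  have h2 : (((d.1 + d.2).val : ℂ)) - (d.1.val : ℂ) - (d.2.val : ℂ) = 5 * (e2 : ℂ) := by exact_mod_cast he2
  linear_combination (-(UpperHalfPlane.ρ : ℂ) / 5) * h1 + (-1 / 5 : ℂ) * h2 + (-(d.1.val : ℂ) / 5) * UpperHalfPlane.ρ_sq

/-- **`X(t_d) ≠ 0` for `d ≠ 0`** (`ψ₅(X(t_d)) = 0` and `ψ₅(0) = −256`). [cite: SilvermanAEC2009, Exercise 3.7] -/
theorem normalizedX_divPointRho_ne_zero {d : ZMod 5 × ZMod 5} (hd : d ≠ 0) :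
    ℘[ofUpperHalfPlane UpperHalfPlane.ρ] (((d.1.val : ℂ) * UpperHalfPlane.ρ + (d.2.val : ℂ)) / 5) /
      (((2 : ℝ) ^ (2 / 3 : ℝ) * Real.Gamma (1 / 3) ^ 3 / (4 * Real.pi) : ℝ) : ℂ) ^ 2 ≠ 0 := by
  obtain ⟨h, -⟩ := psi_five_weierstrassP_div_rho (divPointRho_notMem hd) (five_mul_divPointRho_mem d)
  intro h0
  rw [h0] at h
  norm_num at h

/-- **`π_d` is a root of the reversed `ψ₅`**: `π¹² − 25/4·π⁹ + 15/16·π⁶ + 95/64·π³ − 5/256 = 0` for `π = X(t_d)⁻¹`, `d ≠ 0`.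
[cite: SilvermanAEC2009, Exercise 3.7] -/
theorem F_of_divPointRho {d : ZMod 5 × ZMod 5} (hd : d ≠ 0) :
    (℘[ofUpperHalfPlane UpperHalfPlane.ρ] (((d.1.val : ℂ) * UpperHalfPlane.ρ + (d.2.val : ℂ)) / 5) /
        (((2 : ℝ) ^ (2 / 3 : ℝ) * Real.Gamma (1 / 3) ^ 3 / (4 * Real.pi) : ℝ) : ℂ) ^ 2)⁻¹ ^ 12 -
      25/4 * (℘[ofUpperHalfPlane UpperHalfPlane.ρ] (((d.1.val : ℂ) * UpperHalfPlane.ρ + (d.2.val : ℂ)) / 5) /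
        (((2 : ℝ) ^ (2 / 3 : ℝ) * Real.Gamma (1 / 3) ^ 3 / (4 * Real.pi) : ℝ) : ℂ) ^ 2)⁻¹ ^ 9 +
      15/16 * (℘[ofUpperHalfPlane UpperHalfPlane.ρ] (((d.1.val : ℂ) * UpperHalfPlane.ρ + (d.2.val : ℂ)) / 5) /
        (((2 : ℝ) ^ (2 / 3 : ℝ) * Real.Gamma (1 / 3) ^ 3 / (4 * Real.pi) : ℝ) : ℂ) ^ 2)⁻¹ ^ 6 +
      95/64 * (℘[ofUpperHalfPlane UpperHalfPlane.ρ] (((d.1.val : ℂ) * UpperHalfPlane.ρ + (d.2.val : ℂ)) / 5) /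
        (((2 : ℝ) ^ (2 / 3 : ℝ) * Real.Gamma (1 / 3) ^ 3 / (4 * Real.pi) : ℝ) : ℂ) ^ 2)⁻¹ ^ 3 - 5/256 = 0 := by
  obtain ⟨h, -⟩ := psi_five_weierstrassP_div_rho (divPointRho_notMem hd) (five_mul_divPointRho_mem d)
  have hX := normalizedX_divPointRho_ne_zero hd
  generalize ℘[ofUpperHalfPlane UpperHalfPlane.ρ] (((d.1.val : ℂ) * UpperHalfPlane.ρ + (d.2.val : ℂ)) / 5) /
        (((2 : ℝ) ^ (2 / 3 : ℝ) * Real.Gamma (1 / 3) ^ 3 / (4 * Real.pi) : ℝ) : ℂ) ^ 2 = X at h hX ⊢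
  have key : X ^ 12 * (X⁻¹ ^ 12 - 25/4 * X⁻¹ ^ 9 + 15/16 * X⁻¹ ^ 6 + 95/64 * X⁻¹ ^ 3 - 5/256) =
      -(1/256 : ℂ) * (5 * X ^ 12 - 380 * X ^ 9 - 240 * X ^ 6 + 1600 * X ^ 3 - 256) := by
    field_simp
    ring
  rw [h, mul_zero] at key
  exact (mul_eq_zero.mp key).resolve_left (pow_ne_zero 12 hX)

/-- **`π_{−d} = π_d`** (`t_{−d} ≡ −t_d`, `℘` even), for any normalisation `ϖ`. [folklore] -/
theorem inv_normalizedX_divPointRho_neg (d : ZMod 5 × ZMod 5) (ϖ : ℂ) :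
    (℘[ofUpperHalfPlane UpperHalfPlane.ρ] ((((-d).1.val : ℂ) * UpperHalfPlane.ρ + ((-d).2.val : ℂ)) / 5) / ϖ ^ 2)⁻¹ =
      (℘[ofUpperHalfPlane UpperHalfPlane.ρ] (((d.1.val : ℂ) * UpperHalfPlane.ρ + (d.2.val : ℂ)) / 5) / ϖ ^ 2)⁻¹ := by
  have hmem := divPointRho_neg_add_mem d
  set u : ℂ := (((-d).1.val : ℂ) * UpperHalfPlane.ρ + ((-d).2.val : ℂ)) / 5
  set t : ℂ := ((d.1.val : ℂ) * UpperHalfPlane.ρ + (d.2.val : ℂ)) / 5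
  have e : u = -t + (u + t) := by ring
  rw [e, (ofUpperHalfPlane UpperHalfPlane.ρ).weierstrassP_add_coe _ ⟨_, hmem⟩, (ofUpperHalfPlane UpperHalfPlane.ρ).weierstrassP_neg]

/-- **`[1 − ρ]` on division values, congruence form**: if `u ≡ (1 − ρ)t (mod Λ)`, `u ∉ Λ` and `X(t), X(u) ≠ 0`, then `1 − 4π(t)³ ≠ 0` and
`π(u)·(1 − 4π(t)³) = −3ρ·π(t)` (`π = X⁻¹`; Literature `EisensteinLattice.inv_normalizedX_one_sub_rho_mul`). [cite: Lawden1989, §9.8 eq. (9.8.14)] -/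
theorem inv_normalizedX_of_oneSubRho_congr {t u : ℂ}
    (hmem : u - (1 - (UpperHalfPlane.ρ : ℂ)) * t ∈ (ofUpperHalfPlane UpperHalfPlane.ρ).lattice)
    (hu : u ∉ (ofUpperHalfPlane UpperHalfPlane.ρ).lattice)
    (hXt : ℘[ofUpperHalfPlane UpperHalfPlane.ρ] t / (((2 : ℝ) ^ (2 / 3 : ℝ) * Real.Gamma (1 / 3) ^ 3 / (4 * Real.pi) : ℝ) : ℂ) ^ 2 ≠ 0)
    (hXu : ℘[ofUpperHalfPlane UpperHalfPlane.ρ] u / (((2 : ℝ) ^ (2 / 3 : ℝ) * Real.Gamma (1 / 3) ^ 3 / (4 * Real.pi) : ℝ) : ℂ) ^ 2 ≠ 0) :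
    1 - 4 * ((℘[ofUpperHalfPlane UpperHalfPlane.ρ] t / (((2 : ℝ) ^ (2 / 3 : ℝ) * Real.Gamma (1 / 3) ^ 3 / (4 * Real.pi) : ℝ) : ℂ) ^ 2)⁻¹) ^ 3 ≠ 0 ∧
    (℘[ofUpperHalfPlane UpperHalfPlane.ρ] u / (((2 : ℝ) ^ (2 / 3 : ℝ) * Real.Gamma (1 / 3) ^ 3 / (4 * Real.pi) : ℝ) : ℂ) ^ 2)⁻¹ *
      (1 - 4 * ((℘[ofUpperHalfPlane UpperHalfPlane.ρ] t / (((2 : ℝ) ^ (2 / 3 : ℝ) * Real.Gamma (1 / 3) ^ 3 / (4 * Real.pi) : ℝ) : ℂ) ^ 2)⁻¹) ^ 3) =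
      -3 * (UpperHalfPlane.ρ : ℂ) * (℘[ofUpperHalfPlane UpperHalfPlane.ρ] t / (((2 : ℝ) ^ (2 / 3 : ℝ) * Real.Gamma (1 / 3) ^ 3 / (4 * Real.pi) : ℝ) : ℂ) ^ 2)⁻¹ := by
  have hz : (1 - (UpperHalfPlane.ρ : ℂ)) * t ∉ (ofUpperHalfPlane UpperHalfPlane.ρ).lattice := by
    intro h
    apply hu
    have e : u = (u - (1 - (UpperHalfPlane.ρ : ℂ)) * t) + (1 - (UpperHalfPlane.ρ : ℂ)) * t := by ring
    rw [e]; exact add_mem hmem h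
  have hPu : ℘[ofUpperHalfPlane UpperHalfPlane.ρ] ((1 - (UpperHalfPlane.ρ : ℂ)) * t) = ℘[ofUpperHalfPlane UpperHalfPlane.ρ] u := by
    have e : (1 - (UpperHalfPlane.ρ : ℂ)) * t = u + (-(u - (1 - (UpperHalfPlane.ρ : ℂ)) * t)) := by ring
    rw [e, (ofUpperHalfPlane UpperHalfPlane.ρ).weierstrassP_add_coe _ ⟨_, neg_mem hmem⟩]
  have hX0 : ℘[ofUpperHalfPlane UpperHalfPlane.ρ] ((1 - (UpperHalfPlane.ρ : ℂ)) * t) /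
      (((2 : ℝ) ^ (2 / 3 : ℝ) * Real.Gamma (1 / 3) ^ 3 / (4 * Real.pi) : ℝ) : ℂ) ^ 2 ≠ 0 := by rw [hPu]; exact hXu
  obtain ⟨h34, hinv⟩ := EisensteinLattice.inv_normalizedX_one_sub_rho_mul hz hX0
  rw [hPu] at hinv
  generalize ℘[ofUpperHalfPlane UpperHalfPlane.ρ] t / (((2 : ℝ) ^ (2 / 3 : ℝ) * Real.Gamma (1 / 3) ^ 3 / (4 * Real.pi) : ℝ) : ℂ) ^ 2 = X
    at h34 hinv hXt ⊢
  generalize ℘[ofUpperHalfPlane UpperHalfPlane.ρ] u / (((2 : ℝ) ^ (2 / 3 : ℝ) * Real.Gamma (1 / 3) ^ 3 / (4 * Real.pi) : ℝ) : ℂ) ^ 2 = Y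
    at hinv hXu ⊢
  have hX3 : X ^ 3 ≠ 0 := pow_ne_zero 3 hXt
  have hden : 1 - 4 * (X⁻¹) ^ 3 ≠ 0 := by
    intro h0
    apply h34
    have e : X ^ 3 - 4 = (1 - 4 * (X⁻¹) ^ 3) * X ^ 3 := by field_simp
    rw [e, h0, zero_mul]
  refine ⟨hden, ?_⟩
  rw [hinv]
  field_simp

/-! ## §2 The four labels -/

/-- `e₀ = (0,1)`, `e₁ = (4,1)`, `e₂ = (2,0)`, `e₃ = (4,2)` are nonzero classes. [folklore] -/
theorem e_ne_zero : ((0, 1) : ZMod 5 × ZMod 5) ≠ 0 ∧ ((4, 1) : ZMod 5 × ZMod 5) ≠ 0 ∧ ((2, 0) : ZMod 5 × ZMod 5) ≠ 0 ∧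
    ((4, 2) : ZMod 5 × ZMod 5) ≠ 0 := by decide

/-- `t_{e_1} ≡ (1 − ρ)·t_{e_0} (mod Λ)` (`e_{a+1} = (1−ρ)·e_0` in `ℤ[ρ]/5`). [folklore] -/
theorem divPoint_e_one_congr :
    (((((4, 1) : ZMod 5 × ZMod 5)).1.val : ℂ) * UpperHalfPlane.ρ + ((((4, 1) : ZMod 5 × ZMod 5)).2.val : ℂ)) / 5 -
      (1 - (UpperHalfPlane.ρ : ℂ)) * ((((((0, 1) : ZMod 5 × ZMod 5)).1.val : ℂ) * UpperHalfPlane.ρ + ((((0, 1) : ZMod 5 × ZMod 5)).2.val : ℂ)) / 5) ∈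
        (ofUpperHalfPlane UpperHalfPlane.ρ).lattice := by
  rw [EisensteinLattice.mem_lattice_iff]
  refine ⟨1, 0, ?_⟩
  have h1 : (((((4, 1) : ZMod 5 × ZMod 5)).1.val : ℕ)) = 4 := by decide
  have h2 : (((((4, 1) : ZMod 5 × ZMod 5)).2.val : ℕ)) = 1 := by decide
  have h3 : (((((0, 1) : ZMod 5 × ZMod 5)).1.val : ℕ)) = 0 := by decide
  have h4 : (((((0, 1) : ZMod 5 × ZMod 5)).2.val : ℕ)) = 1 := by decide
  simp only [h1, h2, h3]; push_cast; ring

/-- `t_{e_2} ≡ (1 − ρ)·t_{e_1} (mod Λ)` (`e_{a+1} = (1−ρ)·e_1` in `ℤ[ρ]/5`). [folklore] -/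
theorem divPoint_e_two_congr :
    (((((2, 0) : ZMod 5 × ZMod 5)).1.val : ℂ) * UpperHalfPlane.ρ + ((((2, 0) : ZMod 5 × ZMod 5)).2.val : ℂ)) / 5 -
      (1 - (UpperHalfPlane.ρ : ℂ)) * ((((((4, 1) : ZMod 5 × ZMod 5)).1.val : ℂ) * UpperHalfPlane.ρ + ((((4, 1) : ZMod 5 × ZMod 5)).2.val : ℂ)) / 5) ∈
        (ofUpperHalfPlane UpperHalfPlane.ρ).lattice := by
  rw [EisensteinLattice.mem_lattice_iff]
  refine ⟨-1, -1, ?_⟩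
  have h1 : (((((2, 0) : ZMod 5 × ZMod 5)).1.val : ℕ)) = 2 := by decide
  have h2 : (((((2, 0) : ZMod 5 × ZMod 5)).2.val : ℕ)) = 0 := by decide
  have h3 : (((((4, 1) : ZMod 5 × ZMod 5)).1.val : ℕ)) = 4 := by decide
  have h4 : (((((4, 1) : ZMod 5 × ZMod 5)).2.val : ℕ)) = 1 := by decide
  simp only [h1, h2, h3, h4]; push_cast; linear_combination (-4/5 : ℂ) * UpperHalfPlane.ρ_sq

/-- `t_{e_3} ≡ (1 − ρ)·t_{e_2} (mod Λ)` (`e_{a+1} = (1−ρ)·e_2` in `ℤ[ρ]/5`). [folklore] -/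
theorem divPoint_e_three_congr :
    (((((4, 2) : ZMod 5 × ZMod 5)).1.val : ℂ) * UpperHalfPlane.ρ + ((((4, 2) : ZMod 5 × ZMod 5)).2.val : ℂ)) / 5 -
      (1 - (UpperHalfPlane.ρ : ℂ)) * ((((((2, 0) : ZMod 5 × ZMod 5)).1.val : ℂ) * UpperHalfPlane.ρ + ((((2, 0) : ZMod 5 × ZMod 5)).2.val : ℂ)) / 5) ∈
        (ofUpperHalfPlane UpperHalfPlane.ρ).lattice := by
  rw [EisensteinLattice.mem_lattice_iff]
  refine ⟨0, 0, ?_⟩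
  have h1 : (((((4, 2) : ZMod 5 × ZMod 5)).1.val : ℕ)) = 4 := by decide
  have h2 : (((((4, 2) : ZMod 5 × ZMod 5)).2.val : ℕ)) = 2 := by decide
  have h3 : (((((2, 0) : ZMod 5 × ZMod 5)).1.val : ℕ)) = 2 := by decide
  have h4 : (((((2, 0) : ZMod 5 × ZMod 5)).2.val : ℕ)) = 0 := by decide
  simp only [h1, h2, h4]; push_cast; linear_combination (-2/5 : ℂ) * UpperHalfPlane.ρ_sq

/-- **Label `e_1`**: `π_{e_1} = P_1(π_{e₀}, ρ)` (`e_1 = (1−ρ)^1` mod `5`). [cite: Lawden1989, §9.8 eq. (9.8.14)] -/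
theorem pi_e_one :
    (℘[ofUpperHalfPlane UpperHalfPlane.ρ] ((((((4, 1) : ZMod 5 × ZMod 5)).1.val : ℂ) * UpperHalfPlane.ρ + ((((4, 1) : ZMod 5 × ZMod 5)).2.val : ℂ)) / 5) / (((2 : ℝ) ^ (2 / 3 : ℝ) * Real.Gamma (1 / 3) ^ 3 / (4 * Real.pi) : ℝ) : ℂ) ^ 2)⁻¹ =
      (-64/27 : ℂ) * UpperHalfPlane.ρ * (℘[ofUpperHalfPlane UpperHalfPlane.ρ] ((((((0, 1) : ZMod 5 × ZMod 5)).1.val : ℂ) * UpperHalfPlane.ρ + ((((0, 1) : ZMod 5 × ZMod 5)).2.val : ℂ)) / 5) / (((2 : ℝ) ^ (2 / 3 : ℝ) * Real.Gamma (1 / 3) ^ 3 / (4 * Real.pi) : ℝ) : ℂ) ^ 2)⁻¹ ^ 10 + (128/9 : ℂ) * UpperHalfPlane.ρ * (℘[ofUpperHalfPlane UpperHalfPlane.ρ] ((((((0, 1) : ZMod 5 × ZMod 5)).1.val : ℂ) * UpperHalfPlane.ρ + ((((0, 1) : ZMod 5 × ZMod 5)).2.val : ℂ)) / 5) / (((2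 : ℝ) ^ (2 / 3 : ℝ) * Real.Gamma (1 / 3) ^ 3 / (4 * Real.pi) : ℝ) : ℂ) ^ 2)⁻¹ ^ 7 + (4/3 : ℂ) * UpperHalfPlane.ρ * (℘[ofUpperHalfPlane UpperHalfPlane.ρ] ((((((0, 1) : ZMod 5 × ZMod 5)).1.val : ℂ) * UpperHalfPlane.ρ + ((((0, 1) : ZMod 5 × ZMod 5)).2.val : ℂ)) / 5) / (((2 : ℝ) ^ (2 / 3 : ℝ) * Real.Gamma (1 / 3) ^ 3 / (4 * Real.pi) : ℝ) : ℂ) ^ 2)⁻¹ ^ 4 + (-86/27 : ℂ) * UpperHalfPlane.ρ * (℘[ofUpperHalfPlane UpperHalfPlane.ρ] ((((((0, 1) : ZMod 5 × ZMod 5)).1.val : ℂ) * UpperHalfPlane.ρ + ((((0, 1) : ZMod 5 × ZMod 5)).2.val : ℂ)) / 5) / (((2 : ℝ) ^ (2 / 3 : ℝ) * Real.Gamma (1 / 3) ^ 3 / (4 * Real.pi) : ℝ) : ℂ) ^ 2)⁻¹ := by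
  obtain ⟨h0, h1, h2, h3⟩ := e_ne_zero
  obtain ⟨hne, hrel⟩ := inv_normalizedX_of_oneSubRho_congr divPoint_e_one_congr (divPointRho_notMem h1)
    (normalizedX_divPointRho_ne_zero h0) (normalizedX_divPointRho_ne_zero h1)
  exact label_one_eq (F_of_divPointRho h0) UpperHalfPlane.ρ_sq hrel hne

/-- **Label `e_2`**: `π_{e_2} = P_2(π_{e₀}, ρ)` (`e_2 = (1−ρ)^2` mod `5`). [cite: Lawden1989, §9.8 eq. (9.8.14)] -/
theorem pi_e_two :
    (℘[ofUpperHalfPlane UpperHalfPlane.ρ] ((((((2, 0) : ZMod 5 × ZMod 5)).1.val : ℂ) * UpperHalfPlane.ρ + ((((2, 0) : ZMod 5 × ZMod 5)).2.val : ℂ)) / 5) / (((2 : ℝ) ^ (2 / 3 : ℝ) * Real.Gamma (1 / 3) ^ 3 / (4 * Real.pi) : ℝ) : ℂ) ^ 2)⁻¹ =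
      (-256/81 : ℂ) * UpperHalfPlane.ρ * (℘[ofUpperHalfPlane UpperHalfPlane.ρ] ((((((0, 1) : ZMod 5 × ZMod 5)).1.val : ℂ) * UpperHalfPlane.ρ + ((((0, 1) : ZMod 5 × ZMod 5)).2.val : ℂ)) / 5) / (((2 : ℝ) ^ (2 / 3 : ℝ) * Real.Gamma (1 / 3) ^ 3 / (4 * Real.pi) : ℝ) : ℂ) ^ 2)⁻¹ ^ 10 + (-256/81 : ℂ) * (℘[ofUpperHalfPlane UpperHalfPlane.ρ] ((((((0, 1) : ZMod 5 × ZMod 5)).1.val : ℂ) * UpperHalfPlane.ρ + ((((0, 1) : ZMod 5 × ZMod 5)).2.val : ℂ)) / 5) / (((2 : ℝ) ^ (2 / 3 : ℝ) * Real.Gamma (1 / 3) ^ 3 / (4 * Real.pi) : ℝ) : ℂ) ^ 2)⁻¹ ^ 10 + (544/27 : ℂ) * UpperHalfPlane.ρ * (℘[ofUpperHalfPlane UpperHalfPlane.ρ] ((((((0, 1) : ZMod 5 × ZMod 5)).1.val : ℂ) * UpperHalfPlane.ρ + ((((0, 1) : ZMod 5 × ZMod 5)).2.val : ℂ)) / 5)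 / (((2 : ℝ) ^ (2 / 3 : ℝ) * Real.Gamma (1 / 3) ^ 3 / (4 * Real.pi) : ℝ) : ℂ) ^ 2)⁻¹ ^ 7 + (544/27 : ℂ) * (℘[ofUpperHalfPlane UpperHalfPlane.ρ] ((((((0, 1) : ZMod 5 × ZMod 5)).1.val : ℂ) * UpperHalfPlane.ρ + ((((0, 1) : ZMod 5 × ZMod 5)).2.val : ℂ)) / 5) / (((2 : ℝ) ^ (2 / 3 : ℝ) * Real.Gamma (1 / 3) ^ 3 / (4 * Real.pi) : ℝ) : ℂ) ^ 2)⁻¹ ^ 7 + (-148/27 : ℂ) * UpperHalfPlane.ρ * (℘[ofUpperHalfPlane UpperHalfPlane.ρ] ((((((0, 1) : ZMod 5 × ZMod 5)).1.val : ℂ) * UpperHalfPlane.ρ + ((((0, 1) : ZMod 5 × ZMod 5)).2.val : ℂ)) / 5) / (((2 : ℝ) ^ (2 / 3 : ℝ) * Real.Gamma (1 / 3) ^ 3 / (4 * Real.pi) : ℝ) : ℂ) ^ 2)⁻¹ ^ 4 + (-148/27 : ℂ) * (℘[ofUpperHalfPlane UpperHalfPlane.ρ] ((((((0, 1) : ZMod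 5 × ZMod 5)).1.val : ℂ) * UpperHalfPlane.ρ + ((((0, 1) : ZMod 5 × ZMod 5)).2.val : ℂ)) / 5) / (((2 : ℝ) ^ (2 / 3 : ℝ) * Real.Gamma (1 / 3) ^ 3 / (4 * Real.pi) : ℝ) : ℂ) ^ 2)⁻¹ ^ 4 + (-284/81 : ℂ) * UpperHalfPlane.ρ * (℘[ofUpperHalfPlane UpperHalfPlane.ρ] ((((((0, 1) : ZMod 5 × ZMod 5)).1.val : ℂ) * UpperHalfPlane.ρ + ((((0, 1) : ZMod 5 × ZMod 5)).2.val : ℂ)) / 5) / (((2 : ℝ) ^ (2 / 3 : ℝ) * Real.Gamma (1 / 3) ^ 3 / (4 * Real.pi) : ℝ) : ℂ) ^ 2)⁻¹ + (-284/81 : ℂ) * (℘[ofUpperHalfPlane UpperHalfPlane.ρ] ((((((0, 1) : ZMod 5 × ZMod 5)).1.val : ℂ) * UpperHalfPlane.ρ + ((((0, 1) : ZMod 5 × ZMod 5)).2.val : ℂ)) / 5) / (((2 : ℝ) ^ (2 / 3 : ℝ) * Real.Gamma (1 / 3) ^ 3 / (4 * Real.pi) : ℝ) : ℂ) ^ 2)⁻¹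 := by
  obtain ⟨h0, h1, h2, h3⟩ := e_ne_zero
  obtain ⟨hne, hrel⟩ := inv_normalizedX_of_oneSubRho_congr divPoint_e_two_congr (divPointRho_notMem h2)
    (normalizedX_divPointRho_ne_zero h1) (normalizedX_divPointRho_ne_zero h2)
  rw [pi_e_one] at hrel hne
  exact label_two_eq (F_of_divPointRho h0) UpperHalfPlane.ρ_sq hrel hne

/-- **Label `e_3`**: `π_{e_3} = P_3(π_{e₀}, ρ)` (`e_3 = (1−ρ)^3` mod `5`). [cite: Lawden1989, §9.8 eq. (9.8.14)] -/
theorem pi_e_three :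
    (℘[ofUpperHalfPlane UpperHalfPlane.ρ] ((((((4, 2) : ZMod 5 × ZMod 5)).1.val : ℂ) * UpperHalfPlane.ρ + ((((4, 2) : ZMod 5 × ZMod 5)).2.val : ℂ)) / 5) / (((2 : ℝ) ^ (2 / 3 : ℝ) * Real.Gamma (1 / 3) ^ 3 / (4 * Real.pi) : ℝ) : ℂ) ^ 2)⁻¹ =
      (448/81 : ℂ) * (℘[ofUpperHalfPlane UpperHalfPlane.ρ] ((((((0, 1) : ZMod 5 × ZMod 5)).1.val : ℂ) * UpperHalfPlane.ρ + ((((0, 1) : ZMod 5 × ZMod 5)).2.val : ℂ)) / 5) / (((2 : ℝ) ^ (2 / 3 : ℝ) * Real.Gamma (1 / 3) ^ 3 / (4 * Real.pi) : ℝ) : ℂ) ^ 2)⁻¹ ^ 10 + (-928/27 : ℂ) * (℘[ofUpperHalfPlane UpperHalfPlane.ρ] ((((((0, 1) : ZMod 5 × ZMod 5)).1.val : ℂ) * UpperHalfPlane.ρ + ((((0, 1) : ZMod 5 × ZMod 5)).2.val : ℂ)) / 5) / (((2 : ℝ) ^ (2 / 3 : ℝ) * Real.Gamma (1 / 3) ^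 3 / (4 * Real.pi) : ℝ) : ℂ) ^ 2)⁻¹ ^ 7 + (112/27 : ℂ) * (℘[ofUpperHalfPlane UpperHalfPlane.ρ] ((((((0, 1) : ZMod 5 × ZMod 5)).1.val : ℂ) * UpperHalfPlane.ρ + ((((0, 1) : ZMod 5 × ZMod 5)).2.val : ℂ)) / 5) / (((2 : ℝ) ^ (2 / 3 : ℝ) * Real.Gamma (1 / 3) ^ 3 / (4 * Real.pi) : ℝ) : ℂ) ^ 2)⁻¹ ^ 4 + (623/81 : ℂ) * (℘[ofUpperHalfPlane UpperHalfPlane.ρ] ((((((0, 1) : ZMod 5 × ZMod 5)).1.val : ℂ) * UpperHalfPlane.ρ + ((((0, 1) : ZMod 5 × ZMod 5)).2.val : ℂ)) / 5) / (((2 : ℝ) ^ (2 / 3 : ℝ) * Real.Gamma (1 / 3) ^ 3 / (4 * Real.pi) : ℝ) : ℂ) ^ 2)⁻¹ := by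
  obtain ⟨h0, h1, h2, h3⟩ := e_ne_zero
  obtain ⟨hne, hrel⟩ := inv_normalizedX_of_oneSubRho_congr divPoint_e_three_congr (divPointRho_notMem h3)
    (normalizedX_divPointRho_ne_zero h2) (normalizedX_divPointRho_ne_zero h3)
  rw [pi_e_two] at hrel hne
  exact label_three_eq (F_of_divPointRho h0) UpperHalfPlane.ρ_sq hrel hne

end Summit.BirchSwinnertonDyer.BirchSwinnertonDyer.Theorems.BiquadraticEisensteinDescentManinDatumSupercuspidalCMInertResolventLabelsJZero

end
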